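import Summits.Ventures.PercRepro.RankLevelSetLevelFiveSharpXX
import Summits.Ventures.PercRepro.S2CellsP20C6
import Summits.Ventures.PercRepro.S2SharpCoreXQIC
import Summits.Ventures.PercRepro.S2SharpCoreXMidC
import Summits.Ventures.PercRepro.S2MidFlatsTenC
import Summits.Ventures.PercRepro.S2CoreTwenty
import Summits.Ventures.PercRepro.S2CellsP20XQIC
import Summits.Ventures.PercRepro.S2CellsP20XM
import Summits.Ventures.PercRepro.S2CellsP20X
import Summits.Ventures.PercRepro.S2TailP20X
import Summits.Ventures.PercRepro.S1CoreCapChain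

/-!
# PercRepro — THEOREM C₅ AT `21`: C-025 AT LEVEL `5` FOR EVERY `p ≥ 21` (p7, gen 6; sub-claim S2; the «21» assembly)

The `p = 20` row of the cell map, closed by THREE levers on top of the «22» kit: p2's unconditional `4`-circuit caps
(S1CoreCapChain: `s₄ ≤ 53 / 79 / 114 / 159 / 376` at `ν = 6 / 7 / 8 / 9 / 12`, against T4⁺ `78 / 118 / 170 / 235 / 525`) in the
cap-parametrized cores (S2SharpCoreXQIC / S2SharpCoreXMidC) at `d = 7, 8, 9, 12`; the cobasis lever at `d = 6` (S2CellsP20C6);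
the corank-`10` mid-flat bound on `≤ 31` points (S2MidFlatsTenC); the landed X core at `d ∈ {11, 13, …, 28}`
(S2CellsP20X / S2TailP20X); and the corank-`≥ 29` regime by the sizes `6 … 19` (S2CoreTwenty). Every cell `(20, d)`, `6 ≤ d ≤ 28`,
reads `≤ 0.991` (`(20, 9)`: `0.9907`; `(20, 7)`: `0.9879`). Declarations:
* `c025_core_five_twenty_seven / _eight / _nine / _ten / _twelve` — the cells with a lever;
* **`c025_core_five_twenty_xx`** — the `e`-free core at level `5`, rank `20`, every corank `6 ≤ d ≤ 28`;
* **`c025_five_of_four_sharp_xxi_from`** — for `P ≥ 20`, level `4` for all `p ≥ P` implies level `5` for all `p ≥ P + 1`;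
* **`c025_five_large_sharp21`** — UNCONDITIONAL over the landed tree: C-025 at level `5` for every `p ≥ 21` (level `4`
  from S1's `c025_four_seventeen`); `c025_five_large_sharp21'` is the `C025` spelling.
Axioms: standard. -/

open scoped Matroid

namespace PercRepro

namespace S2

/-- **The `p = 20` cells, dispatched**: for every corank `6 ≤ d ≤ 28`, `d ∉ {6, 7, 8, 9, 10, 12}`, some slack `m ≤ 1024` with
`1024·U′(20, d) ≤ (1024 − m)·2^(d−5)·C(25, 5)` and `1024·T′(20 + d, d) ≤ m·2^(20+d)`. -/
theorem cellsP20X (d : ℕ) (hd6 : 6 ≤ d) (hd28 : d ≤ 28) (hn6 : d ≠ 6) (hn7 : d ≠ 7) (hn8 : d ≠ 8) (hn9 : d ≠ 9)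
    (hn10 : d ≠ 10) (hn12 : d ≠ 12) :
    ∃ m : ℕ, m ≤ 1024 ∧
      (1024 * (((20 + d).choose 5 : ℚ) +
      (∑ j ∈ Finset.range (d - 5), (Nat.choose (min 13 ((d + 6) / 2 + 1 - 2)) j : ℚ) / (((j + 1) + 3 * (j + 1).choose 2 : ℕ) : ℚ)) *
        ((((d * d + 6 - 3 * d) / 2) * (20 + d - 3).choose 3 + S1.fourCircuitBound d * (20 + d - 4).choose 2 + (d + 4).choose 5 * (20 + d - 5) + (d + 5).choose 6 : ℕ) : ℚ) +
      ((∑ j ∈ Finset.range (d - 5), (Nat.choose (min 19 (5 + d) - 6) j : ℚ) / (((j + 1) + 3 * (j + 1).choose 2 : ℕ) : ℚ)) -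
        (∑ j ∈ Finset.range (d - 5), (Nat.choose (min 13 ((d + 6) / 2 + 1 - 2)) j : ℚ) / (((j + 1) + 3 * (j + 1).choose 2 : ℕ) : ℚ))) *
        ((min 19 (5 + d)).choose 6 : ℚ)) ≤
        ((1024 - m : ℕ) : ℚ) * 2 ^ (d - 5) * ((20 + 5).choose 5 : ℚ)) ∧
      (1024 * ((((20 + d).choose 4 * 2 ^ 6 + (20 + d).choose 3 * 2 ^ 3 + (20 + d).choose 2 * 2 + (20 + d) + 1 : ℕ) : ℚ) +
      (((20 + d).choose 5 : ℚ) + (∑ j ∈ Finset.range (d), (Nat.choose (min 13 ((d + 6) / 2 + 1 - 2)) j : ℚ) / (((j + 1) + 3 * (j + 1).choose 2 : ℕ) : ℚ)) * ((((d * d + 6 - 3 * d) / 2) * (20 + d - 3).choose 3 + S1.fourCircuitBound d * (20 + d - 4).choose 2 + (d + 4).choose 5 * (20 + d - 5) + (d + 5).choose 6 : ℕ) : ℚ) +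
        ((∑ j ∈ Finset.range (d), (Nat.choose (min 19 (5 + d) - 6) j : ℚ) / (((j + 1) + 3 * (j + 1).choose 2 : ℕ) : ℚ)) - (∑ j ∈ Finset.range (d), (Nat.choose (min 13 ((d + 6) / 2 + 1 - 2)) j : ℚ) / (((j + 1) + 3 * (j + 1).choose 2 : ℕ) : ℚ))) * ((min 19 (5 + d)).choose 6 : ℚ)) +
      ((∑ j ∈ Finset.range (d + 1), (20 + d).choose j : ℕ) : ℚ)) ≤ (m : ℚ) * 2 ^ (20 + d)) := by
  interval_cases d
  · exact absurd rfl hn6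
  · exact absurd rfl hn7
  · exact absurd rfl hn8
  · exact absurd rfl hn9
  · exact absurd rfl hn10
  · exact ⟨80, by norm_num, cellP20X_poly_11, cellP20X_tail_11⟩
  · exact absurd rfl hn12
  · exact ⟨154, by norm_num, cellP20X_poly_13, cellP20X_tail_13⟩
  · exact ⟨202, by norm_num, cellP20X_poly_14, cellP20X_tail_14⟩
  · exact ⟨257, by norm_num, cellP20X_poly_15, cellP20X_tail_15⟩
  · exact ⟨318, by norm_num, cellP20X_poly_16, cellP20X_tail_16⟩
  · exact ⟨381, by norm_num, cellP20X_poly_17, cellP20X_tail_17⟩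
  · exact ⟨447, by norm_num, cellP20X_poly_18, cellP20X_tail_18⟩
  · exact ⟨513, by norm_num, cellP20X_poly_19, cellP20X_tail_19⟩
  · exact ⟨577, by norm_num, cellP20X_poly_20, cellP20X_tail_20⟩
  · exact ⟨638, by norm_num, cellP20X_poly_21, cellP20X_tail_21⟩
  · exact ⟨695, by norm_num, cellP20X_poly_22, cellP20X_tail_22⟩
  · exact ⟨747, by norm_num, cellP20X_poly_23, cellP20X_tail_23⟩
  · exact ⟨793, by norm_num, cellP20X_poly_24, cellP20X_tail_24⟩
  · exact ⟨834, by norm_num, cellP20X_poly_25, cellP20X_tail_25⟩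
  · exact ⟨870, by norm_num, cellP20X_poly_26, cellP20X_tail_26⟩
  · exact ⟨900, by norm_num, cellP20X_poly_27, cellP20X_tail_27⟩
  · exact ⟨925, by norm_num, cellP20X_poly_28, cellP20X_tail_28⟩

end S2

namespace ThmN

open Set

variable {α : Type}

/-- **The `e`-free core at level `5`, rank `20`, corank `7`**: the cell `(20, 7)` on the XQIC core with p2's cap
`s₄ ≤ 79` (S1CoreCapChain `avgChain 7`), slack `13/1024`. -/
theorem c025_core_five_twenty_seven (M : Matroid α) [M.Finite]
    (hR : M.eRank = ((20 : ℕ) : ℕ∞)) (hn : M.E.ncard = 20 + 7)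
    (hfree : ∀ e ∈ M.E, ∃ A ⊆ M.E \ {e}, e ∉ M.closure A ∧ e ∉ M.closure ((M.E \ {e}) \ A)) :
    RLS M 20 5 := by
  have hd : M.E.encard = M.eRank + ((7 : ℕ) : ℕ∞) := by
    rw [hR, ← M.ground_finite.cast_ncard_eq, hn]
    push_cast
    ring
  have hs4 := S1.ncard_fourCircuits_le_avgChain 7 M hfree hd
  rw [S1.avgChain_values.1] at hs4
  exact c025_core_five_sharp_cell_xqic M 20 7 (by norm_num) (by norm_num) hR hn hfree 79 hs4
    ⟨13, by norm_num, S2.cellP20XQIC_poly_7, S2.cellP20XQIC_tail_7⟩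

/-- **The `e`-free core at level `5`, rank `20`, corank `8`**: the mid spanning sets number `≤ 7·C(12, 6)`
(S2MidFlatsSeven), `s₄ ≤ 114` (p2's S1CoreCapChain), and the cell `(20, 8)` closes with the mid class explicit. -/
theorem c025_core_five_twenty_eight (M : Matroid α) [M.Finite]
    (hR : M.eRank = ((20 : ℕ) : ℕ∞)) (hn : M.E.ncard = 20 + 8)
    (hfree : ∀ e ∈ M.E, ∃ A ⊆ M.E \ {e}, e ∉ M.closure A ∧ e ∉ M.closure ((M.E \ {e}) \ A)) :
    RLS M 20 5 := by
  have hL0 : ∀ e ∈ M.E, ¬ M.IsLoop e := not_isLoop_of_free M hfree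
  have hd : M.E.encard = M.eRank + 8 := by
    rw [hR, ← M.ground_finite.cast_ncard_eq, hn]
    push_cast
    ring
  have hflat' : ∀ X ⊆ M.E, M.eRk X ≤ ((5 - 1 : ℕ) : ℕ∞) → X.ncard ≤ 10 := fun X hX hr =>
    ncard_le_ten_of_eRk_le_four_of_free M hfree hX (by simpa using hr)
  have hC2 : ∀ P ⊆ M.E, M.eRk P ≤ 3 → P.ncard ≤ 6 :=
    fun P hP hr => ncard_le_six_of_eRk_le_three_of_free M hfree hP hr
  have hC0 : ∀ X ⊆ M.E, M.eRk X ≤ 1 → X.ncard ≤ 1 := fun X hX hr => by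
    have := ncard_add_one_le_two_pow_of_eRk_le M hL0 hfree 1 X hX hr
    omega
  have hmid := S2.card_spanMid_le_seven hflat' hC2 hC0 hd
  have hmid' : (S2.spanMid M 5 (min 10 (4 + 8)) ((8 + 6) / 2 + 1)).card ≤ 7 * (12).choose 6 := by
    rw [show min 10 (4 + 8) = 10 by norm_num, show (8 + 6) / 2 + 1 = 8 by norm_num]
    exact hmid
  have hs4 := S1.ncard_fourCircuits_le_avgChain 8 M hfree hd
  rw [S1.avgChain_values.2.1] at hs4
  have key := c025_core_five_sharp_cell_xmidc M 20 8 (7 * (12).choose 6) (by norm_num) hR hn hfree 114 hs4 hmid'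
  exact key S2.cellP20XM7

/-- **The `e`-free core at level `5`, rank `20`, corank `9`**: the cell `(20, 9)` on the XQIC core with p2's cap
`s₄ ≤ 159` (S1CoreCapChain `avgChain 9`), slack `34/1024`. -/
theorem c025_core_five_twenty_nine (M : Matroid α) [M.Finite]
    (hR : M.eRank = ((20 : ℕ) : ℕ∞)) (hn : M.E.ncard = 20 + 9)
    (hfree : ∀ e ∈ M.E, ∃ A ⊆ M.E \ {e}, e ∉ M.closure A ∧ e ∉ M.closure ((M.E \ {e}) \ A)) :
    RLS M 20 5 := by
  have hd : M.E.encard = M.eRank + ((9 : ℕ) : ℕ∞) := by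
    rw [hR, ← M.ground_finite.cast_ncard_eq, hn]
    push_cast
    ring
  have hs4 := S1.ncard_fourCircuits_le_avgChain 9 M hfree hd
  rw [S1.avgChain_values.2.2.1] at hs4
  exact c025_core_five_sharp_cell_xqic M 20 9 (by norm_num) (by norm_num) hR hn hfree 159 hs4
    ⟨34, by norm_num, S2.cellP20XQIC_poly_9, S2.cellP20XQIC_tail_9⟩

/-- **The `e`-free core at level `5`, rank `20`, corank `10`**: the mid spanning sets number `≤ 136,092`
(S2MidFlatsTenC, `|E| = 30 ≤ 31`), and the cell `(20, 10)` closes with the mid class explicit. -/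
theorem c025_core_five_twenty_ten (M : Matroid α) [M.Finite]
    (hR : M.eRank = ((20 : ℕ) : ℕ∞)) (hn : M.E.ncard = 20 + 10)
    (hfree : ∀ e ∈ M.E, ∃ A ⊆ M.E \ {e}, e ∉ M.closure A ∧ e ∉ M.closure ((M.E \ {e}) \ A)) :
    RLS M 20 5 := by
  have hL0 : ∀ e ∈ M.E, ¬ M.IsLoop e := not_isLoop_of_free M hfree
  have hd : M.E.encard = M.eRank + 10 := by
    rw [hR, ← M.ground_finite.cast_ncard_eq, hn]
    push_cast
    ring
  have hs : ∀ e ∈ M.E, ∀ f ∈ M.E, e ≠ f → M.eRk {e, f} = 2 := by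
    intro e he f hf hef
    have h2 : (2 : ℕ∞) ≤ M.eRk {e, f} :=
      two_le_eRk_of_two_le_ncard_of_free M hfree (pair_subset he hf) (by rw [ncard_pair hef])
    have h3 : M.eRk {e, f} ≤ 2 := by
      have := M.eRk_le_encard {e, f}
      rwa [encard_pair hef] at this
    exact le_antisymm h3 h2
  have hC1 : ∀ L ⊆ M.E, M.eRk L = 2 → L.ncard ≤ 3 :=
    fun L hL hr => ncard_le_three_of_eRk_two M hs hfree hL hr
  have hflat' : ∀ X ⊆ M.E, M.eRk X ≤ ((5 - 1 : ℕ) : ℕ∞) → X.ncard ≤ 10 := fun X hX hr =>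
    ncard_le_ten_of_eRk_le_four_of_free M hfree hX (by simpa using hr)
  have hC2 : ∀ P ⊆ M.E, M.eRk P ≤ 3 → P.ncard ≤ 6 :=
    fun P hP hr => ncard_le_six_of_eRk_le_three_of_free M hfree hP hr
  have hC0 : ∀ X ⊆ M.E, M.eRk X ≤ 1 → X.ncard ≤ 1 := fun X hX hr => by
    have := ncard_add_one_le_two_pow_of_eRk_le M hL0 hfree 1 X hX hr
    omega
  have hmid := S2.card_spanMid_le_ten_le hC1 hflat' hC2 hC0 hd (by omega)
  have hmid' : (S2.spanMid M 5 (min 10 (4 + 10)) ((10 + 6) / 2 + 1)).card ≤ 136092 := by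
    rw [show min 10 (4 + 10) = 10 by norm_num, show (10 + 6) / 2 + 1 = 9 by norm_num]
    exact hmid
  have key := c025_core_five_sharp_cell_xmid M 20 10 136092 (by norm_num) hR hn hfree hmid'
  exact key S2.cellP20XM10

/-- **The `e`-free core at level `5`, rank `20`, corank `12`**: the cell `(20, 12)` on the XQIC core with p2's cap
`s₄ ≤ 376` (S1CoreCapChain `avgChain 12`), slack `112/1024`. -/
theorem c025_core_five_twenty_twelve (M : Matroid α) [M.Finite]
    (hR : M.eRank = ((20 : ℕ) : ℕ∞)) (hn : M.E.ncard = 20 + 12)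
    (hfree : ∀ e ∈ M.E, ∃ A ⊆ M.E \ {e}, e ∉ M.closure A ∧ e ∉ M.closure ((M.E \ {e}) \ A)) :
    RLS M 20 5 := by
  have hd : M.E.encard = M.eRank + ((12 : ℕ) : ℕ∞) := by
    rw [hR, ← M.ground_finite.cast_ncard_eq, hn]
    push_cast
    ring
  have hs4 := S1.ncard_fourCircuits_le_avgChain 12 M hfree hd
  rw [S1.avgChain_values.2.2.2.2.2] at hs4
  exact c025_core_five_sharp_cell_xqic M 20 12 (by norm_num) (by norm_num) hR hn hfree 376 hs4
    ⟨112, by norm_num, S2.cellP20XQIC_poly_12, S2.cellP20XQIC_tail_12⟩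

/-- **The `e`-free core at level `5`, rank `20`, every corank `6 ≤ d ≤ 28`**. -/
theorem c025_core_five_twenty_xx (M : Matroid α) [M.Finite] (d : ℕ)
    (hd6 : 6 ≤ d) (hd28 : d ≤ 28) (hR : M.eRank = ((20 : ℕ) : ℕ∞)) (hn : M.E.ncard = 20 + d)
    (hfree : ∀ e ∈ M.E, ∃ A ⊆ M.E \ {e}, e ∉ M.closure A ∧ e ∉ M.closure ((M.E \ {e}) \ A)) :
    RLS M 20 5 := by
  by_cases h6 : d = 6
  · subst h6; exact c025_core_five_twenty_six M hR hn hfree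
  by_cases h7 : d = 7
  · subst h7; exact c025_core_five_twenty_seven M hR hn hfree
  by_cases h8 : d = 8
  · subst h8; exact c025_core_five_twenty_eight M hR hn hfree
  by_cases h9 : d = 9
  · subst h9; exact c025_core_five_twenty_nine M hR hn hfree
  by_cases h10 : d = 10
  · subst h10; exact c025_core_five_twenty_ten M hR hn hfree
  by_cases h12 : d = 12
  · subst h12; exact c025_core_five_twenty_twelve M hR hn hfree
  exact c025_core_five_sharp_cell_x M 20 d hd6 hR hn hfree (S2.cellsP20X d hd6 hd28 h6 h7 h8 h9 h10 h12)

/-- **THEOREM C₅, GIVEN LEVEL `4` FROM `P ≥ 20`**: level `4` for all `p ≥ P` implies level `5` for all `p ≥ P + 1`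
(the `p = 20` row by `c025_core_five_twenty_xx` / `c025_core_five_at_twenty_big`, the rows `p ≥ 21` by the «22» kit). -/
theorem c025_five_of_four_sharp_xxi_from (P : ℕ) (hP : 20 ≤ P)
    (h4 : ∀ (M : Matroid α) [M.Finite] (p : ℕ), P ≤ p → RLS M p 4) :
    ∀ (M : Matroid α) [M.Finite] (p : ℕ), P + 1 ≤ p → RLS M p 5 := by
  rcases Nat.lt_or_ge P 21 with hP20 | hP21
  · have hP' : P = 20 := by omega
    subst hP'
    refine S2.rls_five_of_four_of_core 20 (by omega) h4 ?_
    intro M _ p hP' hR hbig hfree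
    rcases Nat.lt_or_ge p 21 with h20 | h21
    · have hp' : p = 20 := by omega
      subst hp'
      rcases Nat.lt_or_ge M.E.ncard (20 + 29) with h | h
      · exact c025_core_five_twenty_xx M (M.E.ncard - 20) (by omega) (by omega) hR (by omega) hfree
      · exact c025_core_five_at_twenty_big M (by omega) hfree
    rcases Nat.lt_or_ge p 22 with h21' | h22
    · have hp' : p = 21 := by omega
      subst hp'
      rcases Nat.lt_or_ge M.E.ncard (21 + 29) with h | h
      · exact c025_core_five_twentyone_xx M (M.E.ncard - 21) (by omega) (by omega) hR (by omega) hfree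
      · exact c025_core_five_nineteen_at_twentyone M (by omega) hfree
    · exact c025_five_of_four_sharp_xx_from 21 le_rfl (fun M _ p hp => h4 M p (by omega)) M p h22
  · exact c025_five_of_four_sharp_xx_from P hP21 h4

/-- **THEOREM C₅ AT `21`**: every finite matroid satisfies C-025 at level `5` for every `p ≥ 21` (level `4` from S1's
`c025_four_seventeen`). -/
theorem c025_five_large_sharp21 (M : Matroid α) [M.Finite] (p : ℕ) (hp : 21 ≤ p) : RLS M p 5 :=
  c025_five_of_four_sharp_xxi_from 20 le_rfl (fun M _ p hp => S1.c025_four_seventeen M p (by omega)) M p hp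

/-- The level-`5` statement at `p ≥ 21` in the vocabulary of `C025`. -/
theorem c025_five_large_sharp21' (M : Matroid α) [M.Finite] (p : ℕ) (hp : 21 ≤ p) :
    phiK p 5 * ({A : Set α | A ⊆ M.E ∧ M.eRk A = (p : ℕ∞) ∧ M.eRk (M.E \ A) = (5 : ℕ∞)}.ncard : ℚ) ≤
      ({A : Set α | A ⊆ M.E ∧ (5 : ℕ∞) < M.eRk A ∧ M.eRk A < (p : ℕ∞)}.ncard : ℚ) :=
  c025_five_large_sharp21 M p hp

end ThmN

end PercRepro
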